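import Mathlib
import Literature.MathematicalPhysics.QuantumFieldTheory.Balaban1983to89.B5DivOrth

/-!
# B5 p. 23: «Because u_k(l) = 0 for l ≠ 0, u_k(0) = 1» — the zero fiber `p′ = 0` of `Q_k` and of
# `Q_k^*Q_k` in position space IS pass 5's `Qv₀` (the `p′ = 0` case of (1.83)/(1.84))

Source: T. Bałaban, *Propagators and renormalization transformations for lattice gauge
theories. I*, Commun. Math. Phys. 95 (1984) 17–40 (`Balaban1984PropagatorsI`, "B5"), renders
`b2b-balaban-ref1/pages/1984-cmp95-propagators-rt-I/…-pNNN-x2.png` (PDF page = journal page − 16),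
read as images.

## What the paper prints (verbatim)

* p. 23 [PDF 7], (1.31) and after: «u_k(p) = Π_{μ=1}^{d} (e^{ip′_μ} − 1)/((e^{iηp_μ} − 1)/η)
  = Π_{μ=1}^{d} ∂¹_μ(p′)/∂_μ(p),»; «p ∈ T̃_η is represented as a sum p = p′ + l, p′ ∈ T̃₁^{(k)} and
  l = (l₁, …, l_d), l_μ = 2πm_μ, m_μ is an integer»; «Because u_k(l) = 0 for l ≠ 0, u_k(0) = 1».
* p. 30 [PDF 14], (1.74): «a⟨1, Q*QA_μ⟩ = a⟨1, A_μ⟩ = ⟨1, J_μ⟩, so ⟨1, A_μ⟩ = a⁻¹⟨1, J_μ⟩»; p. 31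
  [PDF 15], (1.83): «Ã_μ(0) = a⁻¹ J̃_μ(0)».

## What is typed and certified here (kernel-checked, zero sorry)

With pass 3's symbols (`vSym`, `uSym`, continuous extension `v_μ := 1` where `∂_μ = 0`), pass 8's
position-space `QvOp = Q_k` and its momentum representation `dft_QvOp`, pass 13's
`dft_QvOp_adjoint_QvOp`, and pass 5's zero-fiber matrix `Qv₀`:
* `vSym_zero`, `uSym_zero`, `uSym_vSym_zero` — AT `p′ = 0`: `v_μ(l) = δ_{l_μ 0}`, «u_k(l) = 0 for
  l ≠ 0, u_k(0) = 1», `u_k(l)v_μ(l) = δ_{l0}`;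
* `pOf_zero`; `dft_QvOp_zero` — `(Q_kA)^_μ(0) = c_Q · Â_μ(0)`: the zero mode of the average is the
  zero mode of the field (the content of «⟨1, Q*QA_μ⟩ = ⟨1, A_μ⟩» (1.74), cf. pass 10 `sum_QvOp`);
* `dft_QvOp_zero_fiber`, `dft_QstarQ_zero_fiber` — THE IDENTIFICATION with pass 5 at `p′ = 0`:
  `(Q_kA)^_μ(0) = c_Q Σ_i (Qv₀ 0)_{μ,i} Â_i`, `(Q_k^*Q_kA)^_κ(l) = c_Q² Σ_i (Qv₀^*Qv₀)_{(l,κ),i} Â_i` on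
  the fiber over `p′ = 0` — pass 5's `Qv₀`/`Da₀` describe B5's `Q`, `Q*Q` there (complementing
  `B5FiberQQ.fiber_QstarQ`, which needs `p′ ≠ 0`).

## What is NOT certified here

Nothing about `P` (which has no `p′ = 0` component, p. 22/23) beyond pass 5; fields complex;
`c_Q = cQ n M` is the unitary-DFT normalisation of pass 8 (B5's own conventions absorb it).
-/

open scoped BigOperators Matrix ComplexConjugate
open Finset Complex

namespace Literature.MathematicalPhysics.QuantumFieldTheory.Balaban1983to89.B5FiberZero

open Literature.MathematicalPhysics.QuantumFieldTheory.Balaban1983to89.B4Strip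
open Literature.MathematicalPhysics.QuantumFieldTheory.Balaban1983to89.B5Prop11Fiber
open Literature.MathematicalPhysics.QuantumFieldTheory.Balaban1983to89.B5Prop11Plancherel
open Literature.MathematicalPhysics.QuantumFieldTheory.Balaban1983to89.B5Prop11Inverse
open Literature.MathematicalPhysics.QuantumFieldTheory.Balaban1983to89.B5Action121
open Literature.MathematicalPhysics.QuantumFieldTheory.Balaban1983to89.B5Block118
open Literature.MathematicalPhysics.QuantumFieldTheory.Balaban1983to89.B5FiberQQ

noncomputable section

section Symbols

variable {d : ℕ} (n : ℕ) [NeZero n]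

/-- at `p′ = 0`: `v_μ(l) = 1` if `l_μ = 0`, `= 0` otherwise (`∂¹_μ(0) = 0`, and `∂_μ(l) = 0 ⟺ l_μ = 0`).
[cite: Balaban1984PropagatorsI, (1.31) p.23] -/
theorem vSym_zero (hn : 1 ≤ n) (k : Fin d → Fin n) (μ : Fin d) :
    vSym n k 0 μ = if k μ = 0 then 1 else 0 := by
  have hs : |(0 : Fin d → ℝ) μ| ≤ Real.pi := by simp [Real.pi_pos.le]
  have hiff := dSym_eq_zero_iff n hn k 0 μ hs
  simp only [Pi.zero_apply, true_and] at hiff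
  unfold vSym
  by_cases h : k μ = 0
  · rw [if_pos (hiff.mpr h), if_pos h]
  · rw [if_neg (fun h' => h (hiff.mp h')), if_neg h]
    simp [d1Sym]

/-- p. 23: «Because u_k(l) = 0 for l ≠ 0, u_k(0) = 1». [cite: Balaban1984PropagatorsI, (1.31) p.23] -/
theorem uSym_zero (hn : 1 ≤ n) (k : Fin d → Fin n) : uSym n k 0 = if k = 0 then 1 else 0 := by
  unfold uSym
  simp_rw [vSym_zero n hn]
  rw [Finset.prod_boole]
  congr 1
  simp only [Finset.mem_univ, true_implies, funext_iff, Pi.zero_apply]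

/-- at `p′ = 0`: `u_k(l) v_μ(l) = δ_{l0}`. [cite: Balaban1984PropagatorsI, (1.31) p.23] -/
theorem uSym_vSym_zero (hn : 1 ≤ n) (k : Fin d → Fin n) (μ : Fin d) :
    uSym n k 0 * vSym n k 0 μ = if k = 0 then 1 else 0 := by
  rw [uSym_zero n hn, vSym_zero n hn]
  by_cases h : k = 0
  · subst h
    simp
  · simp [h]

end Symbols

variable {d : ℕ} (n : ℕ) [NeZero n] (M : Fin d → ℕ) [hM : ∀ μ, NeZero (M μ)]

omit hM in
/-- the momentum `p = p′ + l` with `p′ = 0`, `l = 0` is `p = 0`. [folklore] -/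
@[simp] theorem pOf_zero : pOf n M ((0 : Fin d → Fin n), (0 : Tor M)) = 0 := by
  funext ν
  simp [pOf]

/-- `(Q_kA)^_μ(0) = c_Q · Â_μ(0)`: the zero mode of the block average is the zero mode of the field
((1.74) «⟨1, Q*QA_μ⟩ = ⟨1, A_μ⟩»). [cite: Balaban1984PropagatorsI, (1.74) p.30] -/
theorem dft_QvOp_zero (hn : 1 ≤ n) (A : Tor (fine n M) × Fin d → ℂ) (μ : Fin d) :
    (dft M *ᵥ comp M (QvOp n M *ᵥ A) μ) 0
      = (cQ n M : ℂ) * (dft (fine n M) *ᵥ comp (fine n M) A μ) 0 := by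
  rw [dft_QvOp, sOf_zero]
  simp_rw [uSym_vSym_zero n hn]
  simp only [ite_mul, one_mul, zero_mul, Finset.sum_ite_eq', Finset.mem_univ, if_true, pOf_zero]

/-- THE IDENTIFICATION at `p′ = 0` for `Q`: `(Q_kA)^_μ(0) = c_Q Σ_i (Qv₀ 0)_{μ,i} Â_{i.2}(0 + l_{i})` with
pass 5's `Qv₀` (origin `o = 0`). [cite: Balaban1984PropagatorsI, (1.83) p.31] -/
theorem dft_QvOp_zero_fiber (hn : 1 ≤ n) (A : Tor (fine n M) × Fin d → ℂ) (μ : Fin d) :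
    (dft M *ᵥ comp M (QvOp n M *ᵥ A) μ) 0
      = (cQ n M : ℂ) * ∑ i : (Fin d → Fin n) × Fin d,
          Qv₀ (0 : Fin d → Fin n) μ i * (dft (fine n M) *ᵥ comp (fine n M) A i.2) (pOf n M (i.1, 0)) := by
  rw [dft_QvOp_zero n M hn]
  congr 1
  simp only [Qv₀, ite_mul, one_mul, zero_mul, Finset.sum_ite_eq', Finset.mem_univ, if_true,
    pOf_zero]

/-- THE IDENTIFICATION at `p′ = 0` for `Q*Q`: `(Q_k^*Q_kA)^_κ(l) = c_Q² Σ_i (Qv₀^*Qv₀)_{(l,κ),i} Â_i` on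
the fiber over `p′ = 0` — pass 5's `Da₀ = Δ + aQv₀^*Qv₀` describes `Δ + aQ*Q` there.
[cite: Balaban1984PropagatorsI, (1.83) p.31] -/
theorem dft_QstarQ_zero_fiber (hn : 1 ≤ n) (A : Tor (fine n M) × Fin d → ℂ)
    (k : Fin d → Fin n) (κ : Fin d) :
    (dft (fine n M) *ᵥ comp (fine n M) ((QvOp n M)ᴴ *ᵥ (QvOp n M *ᵥ A)) κ) (pOf n M (k, 0))
      = (cQ n M : ℂ) ^ 2 * ∑ i : (Fin d → Fin n) × Fin d,
          ((Qv₀ (d := d) (0 : Fin d → Fin n))ᴴ * Qv₀ (d := d) (0 : Fin d → Fin n)) (k, κ) i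
            * (dft (fine n M) *ᵥ comp (fine n M) A i.2) (pOf n M (i.1, 0)) := by
  rw [dft_QvOp_adjoint_QvOp, sOf_zero, Qv₀H_mul_Qv₀]
  simp_rw [uSym_vSym_zero n hn]
  have hL : ∑ k' : Fin d → Fin n, (if k' = 0 then (1 : ℂ) else 0)
        * (dft (fine n M) *ᵥ comp (fine n M) A κ) (pOf n M (k', 0))
      = (dft (fine n M) *ᵥ comp (fine n M) A κ) (pOf n M (0, 0)) := by
    simp only [ite_mul, one_mul, zero_mul, Finset.sum_ite_eq', Finset.mem_univ, if_true]
  have hR : ∑ i : (Fin d → Fin n) × Fin d,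
        (Matrix.diagonal (fun i : (Fin d → Fin n) × Fin d =>
            if i.1 = (0 : Fin d → Fin n) then (1 : ℂ) else 0)) (k, κ) i
          * (dft (fine n M) *ᵥ comp (fine n M) A i.2) (pOf n M (i.1, 0))
      = (if k = 0 then (1 : ℂ) else 0) * (dft (fine n M) *ᵥ comp (fine n M) A κ) (pOf n M (k, 0)) :=
    Matrix.mulVec_diagonal (fun i : (Fin d → Fin n) × Fin d =>
        if i.1 = (0 : Fin d → Fin n) then (1 : ℂ) else 0)
      (fun i => (dft (fine n M) *ᵥ comp (fine n M) A i.2) (pOf n M (i.1, 0))) (k, κ)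
  rw [hL, hR]
  by_cases hk : k = 0
  · subst hk
    simp
  · simp [hk]

end

end Literature.MathematicalPhysics.QuantumFieldTheory.Balaban1983to89.B5FiberZero
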